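import Summits.CriticalPhenomena.PercolationContinuityZ3.Theorems.PercLowPointHalfSpaceQuantitativeBGNThinFootPacking
import Summits.CriticalPhenomena.PercolationContinuityZ3.Theses.PercLowPointHalfSpace
import Summits.CriticalPhenomena.PercolationContinuityZ3.Theorems.PercLowPointHalfSpaceQuantitativeBGNKlTransfer
import Summits.CriticalPhenomena.PercolationContinuityZ3.Theorems.PercLowPointHalfSpaceQuantitativeBGNMirrorSymm
import Summits.CriticalPhenomena.PercolationContinuityZ3.Theorems.PercLowPointHalfSpaceQuantitativeBGNMirrorSealing
import Literature.Probability.Percolation.TwoGhostInequalityProofs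
import Literature.Probability.Percolation.FiniteEnergy
import Literature.Probability.Percolation.HalfSpaceProofs
import Literature.Probability.Percolation.MeanFieldBetaFromGamma
import Literature.Probability.Percolation.CriticalContinuityProofs
import HarnessLib

/-!
# Thin-foot packing (crux `QuantitativeBGN`, stmt-CriticalPhenomena-0913), part 2: the costume check of `stub_thinFootRel`

Line `mirror-akn-two-arm-import`, lead prover-line-stmt-CriticalPhenomena-0913-c1-0; `--supports stmt-CriticalPhenomena-0913`.

* `ThinFootPacking.real_infinite_dn_eq_zero` — at `p_c(ℤ³)` the `H⁻`-cluster of `0` is a.s. finite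
  (`stub_mirrorSymm` + `tendsto_real_clusterSizeGe` + Barsky–Grimmett–Newman, all in tree).
* `thinFoot_packing_criticalProb` — **`P_{p_c}(volDn n ∩ footLe k) ≤ k (1 − p_c)^{-k} / n`** (`n ≥ 1`).
* `quantitativeBGN_of_thinFootRel_direct` (registered sub-goal) — the registered stub `stub_thinFootRel`
  (`c n^{-b} w(n)^{K+1} ≤ P_{p_c}(volDn n ∩ footLe k)`, `b < 1/2`; hypothesis verbatim) gives AT ONCE
  `w(n) ≤ C n^{-(1−b)/(K+1)}` and the crux through the landed station `quantitativeBGN_of_surfaceVolumeTail`,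
  WITHOUT mirror squaring or the two-ghost inequality and with a better exponent than the line's
  `(1/2 − b)/(K+2)`: the stub already contains a power-law decay of the half-space volume tail, i.e. it is a
  costume of the crux rather than a reduction through the line's lever (recorded so that the line is re-centred
  on `stub_mirrorNonCoalescenceRel`).
No new definitions.
-/

noncomputable section

namespace Summit.CriticalPhenomena.PercolationContinuityZ3.Theorems

open MeasureTheory Filter
open Literature.Probability.Percolation Literature.Probability.LatticeModels
open scoped ENNReal Topology
namespace ThinFootPacking

/-! ### Algebra: from a power bound to a tail bound -/

/-- If `0 ≤ w`, `0 < c`, `0 ≤ C₀`, `1 ≤ m` and `c n^{-b} w^m ≤ C₀ n^{-s}` with `n ≥ 1`, then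
`w ≤ (C₀/c)^{1/m} · n^{-((s−b)/m)}`. -/
theorem tail_bound_of_pow_bound {w c C₀ b s : ℝ} {n m : ℕ} (hn : 1 ≤ n) (hm : 1 ≤ m) (hw : 0 ≤ w)
    (hc : 0 < c) (hC : 0 ≤ C₀) (h : c * (n : ℝ) ^ (-b) * w ^ m ≤ C₀ * (n : ℝ) ^ (-s)) :
    w ≤ (C₀ / c) ^ (1 / (m : ℝ)) * (n : ℝ) ^ (-((s - b) / m)) := by
  have hn0 : (0 : ℝ) < n := by exact_mod_cast hn
  have hm0 : (0 : ℝ) < m := by exact_mod_cast hm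
  have hnb : 0 < (n : ℝ) ^ (-b) := Real.rpow_pos_of_pos hn0 _
  have h2 : w ^ m ≤ C₀ / c * (n : ℝ) ^ (b - s) := by
    have e : C₀ / c * (n : ℝ) ^ (b - s) = C₀ * (n : ℝ) ^ (-s) / (c * (n : ℝ) ^ (-b)) := by
      rw [show b - s = -s - -b by ring, Real.rpow_sub hn0]
      field_simp
    rw [e, le_div_iff₀ (mul_pos hc hnb)]
    linarith [h]
  have hwm : w = (w ^ m) ^ (1 / (m : ℝ)) := by
    rw [← Real.rpow_natCast w m, ← Real.rpow_mul hw, mul_one_div_cancel hm0.ne', Real.rpow_one]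
  rw [hwm]
  refine (Real.rpow_le_rpow (pow_nonneg hw m) h2 (by positivity)).trans (le_of_eq ?_)
  rw [Real.mul_rpow (div_nonneg hC hc.le) (Real.rpow_nonneg hn0.le _), ← Real.rpow_mul hn0.le]
  congr 2
  field_simp
  ring

/-! ### The infinite lower half-space cluster has probability `0` at `p_c` (BGN) -/

/-- At `p_c(ℤ³)` the `H⁻`-cluster of `0` is a.s. finite: `P(|C_{H⁻}(0)| ≥ m) = w(m)` (STUB 1, landed) tends to
`θ_H(p_c) = 0` (Barsky–Grimmett–Newman, in tree). -/
theorem real_infinite_dn_eq_zero :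
    (bondPercolation (zdGraph 3) (criticalProbI 3)).real
        {ω | (openClusterIn (withinGraph (zdGraph 3) {x : Site 3 | x 0 ≤ 0}) ω 0).Infinite} = 0 := by
  set P := bondPercolation (zdGraph 3) (criticalProbI 3) with hP
  set Inf : Set (BondConfig (Site 3)) :=
    {ω | (openClusterIn (withinGraph (zdGraph 3) {x : Site 3 | x 0 ≤ 0}) ω 0).Infinite} with hInf
  have hle : ∀ m : ℕ, P.real Inf ≤
      (bondPercolation (halfSpaceGraph 3) (criticalProbI 3)).real (clusterSizeGe (halfSpaceOrigin 3) m) := by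
    intro m
    rw [← (stub_mirrorSymm (criticalProbI 3) m).2]
    refine measureReal_mono (fun ω hω => ?_)
    have hω' : (openClusterIn (withinGraph (zdGraph 3) {x : Site 3 | x 0 ≤ 0}) ω 0).Infinite := hω
    show (m : ℕ∞) ≤ (openClusterIn (withinGraph (zdGraph 3) {x : Site 3 | x 0 ≤ 0}) ω 0).encard
    rw [hω'.encard_eq]
    exact le_top
  have hθ : theta (halfSpaceGraph 3) (halfSpaceOrigin 3) (criticalProbI 3) = 0 := BarskyGrimmettNewman1991_Z3_holds
  have ht := tendsto_real_clusterSizeGe (halfSpaceGraph 3) (halfSpaceOrigin 3) (criticalProbI 3)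
  rw [hθ] at ht
  exact le_antisymm (ge_of_tendsto' ht hle) measureReal_nonneg

end ThinFootPacking

open ThinFootPacking in
/-- **Thin-foot packing bound at `p_c(ℤ³)`**: `P_{p_c}(|C_{H⁻}(0)| ≥ n, |foot| ≤ k) ≤ k (1 − p_c)^{-k} / n` for
`n ≥ 1` — large half-space clusters touching the wall in boundedly many sites are (at least) `1/n`-rare. Uses BGN
(`real_infinite_dn_eq_zero`) to drop the infinite-cluster term and `p_c < 1`. -/
theorem thinFoot_packing_criticalProb (n k : ℕ) (hn : 1 ≤ n) :
    (bondPercolation (zdGraph 3) (criticalProbI 3)).real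
        ({ω | (n : ℕ∞) ≤ (openClusterIn (withinGraph (zdGraph 3) {x : Site 3 | x 0 ≤ 0}) ω 0).encard} ∩
          {ω | (openClusterIn (withinGraph (zdGraph 3) {x : Site 3 | x 0 ≤ 0}) ω 0 ∩ {x : Site 3 | x 0 = 0}).encard ≤ k}) ≤
      (k : ℝ) * ((1 - criticalProb (zdGraph 3) (0 : Site 3)) ^ k)⁻¹ / n := by
  have hpc1 : criticalProb (zdGraph 3) (0 : Site 3) < 1 := criticalProb_zd_lt_one (d := 3) (by norm_num)
  have hq : 0 < (1 - criticalProb (zdGraph 3) (0 : Site 3)) ^ k := pow_pos (by linarith) k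
  have h := thinFoot_packing (criticalProbI 3) n k hn
  rw [real_infinite_dn_eq_zero, add_zero] at h
  have hcoe : ((criticalProbI 3 : unitInterval) : ℝ) = criticalProb (zdGraph 3) (0 : Site 3) := rfl
  rw [hcoe] at h
  rw [mul_comm] at h
  rw [le_div_iff₀ (by exact_mod_cast (show 0 < n by omega) : (0 : ℝ) < n)]
  have := (le_div_iff₀ hq).mpr h
  calc _ = (bondPercolation (zdGraph 3) (criticalProbI 3)).real _ * n := rfl
    _ ≤ (k : ℝ) / n / (1 - criticalProb (zdGraph 3) (0 : Site 3)) ^ k * n := by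
        exact mul_le_mul_of_nonneg_right this (by positivity)
    _ = (k : ℝ) * ((1 - criticalProb (zdGraph 3) (0 : Site 3)) ^ k)⁻¹ := by
        field_simp

open ThinFootPacking in
/-- **`stub_thinFootRel` gives the crux DIRECTLY (costume check).** The registered stub of line
`mirror-akn-two-arm-import` (by the concurrent lead, 2026-08-16), hypothesis verbatim, together with the
packing bound `thinFoot_packing_criticalProb`, yields `w(n)^{K+1} ≤ (k(1−p_c)^{-k}/c) n^{-(1−b)}`, hence the
polynomial volume tail `w(n) ≤ C n^{-(1−b)/(K+1)}` and `QuantitativeBGN` with `a = (1−b)/(K+1)` — without mirror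
squaring and without the two-ghost inequality (and `(1−b)/(K+1) > (1/2−b)/(K+2)`, the line's exponent). So the
stub already contains a power-law decay of the half-space volume tail: it is not a reduction through the
line's lever. [cite: Hutchcroft2020Locality, §2 (vertex mass transport on ℤ^d; the packing argument is this file's)] -/
theorem quantitativeBGN_of_thinFootRel_direct :
    (∃ (k K : ℕ) (b c : ℝ), b < 1 / 2 ∧ 0 < c ∧ ∀ n : ℕ, 1 ≤ n → c * (n : ℝ) ^ (-b) *
      (Literature.Probability.Percolation.bondPercolation (Literature.Probability.LatticeModels.zdGraph 3)
        (Literature.Probability.Percolation.criticalProbI 3)).real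
        {ω | (n : ℕ∞) ≤ (Literature.Probability.Percolation.openClusterIn
          (Literature.Probability.Percolation.withinGraph (Literature.Probability.LatticeModels.zdGraph 3)
            {x : Literature.Probability.LatticeModels.Site 3 | x 0 ≤ 0}) ω 0).encard} ^ (K + 1) ≤
      (Literature.Probability.Percolation.bondPercolation (Literature.Probability.LatticeModels.zdGraph 3)
        (Literature.Probability.Percolation.criticalProbI 3)).real
        ({ω | (n : ℕ∞) ≤ (Literature.Probability.Percolation.openClusterIn
            (Literature.Probability.Percolation.withinGraph (Literature.Probability.LatticeModels.zdGraph 3)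
              {x : Literature.Probability.LatticeModels.Site 3 | x 0 ≤ 0}) ω 0).encard} ∩
          {ω | (Literature.Probability.Percolation.openClusterIn
            (Literature.Probability.Percolation.withinGraph (Literature.Probability.LatticeModels.zdGraph 3)
              {x : Literature.Probability.LatticeModels.Site 3 | x 0 ≤ 0}) ω 0 ∩
            {x : Literature.Probability.LatticeModels.Site 3 | x 0 = 0}).encard ≤ k})) →
      Summit.CriticalPhenomena.PercolationContinuityZ3.Theses.PercLowPointHalfSpace.QuantitativeBGN := by
  rintro ⟨k, K, b, c, hb, hc, h⟩
  set C₁ : ℝ := (k : ℝ) * ((1 - criticalProb (zdGraph 3) (0 : Site 3)) ^ k)⁻¹ with hC₁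
  have hpc1 : criticalProb (zdGraph 3) (0 : Site 3) < 1 := criticalProb_zd_lt_one (d := 3) (by norm_num)
  have hC₁0 : 0 ≤ C₁ := by
    have : 0 < (1 - criticalProb (zdGraph 3) (0 : Site 3)) ^ k := pow_pos (by linarith) k
    positivity
  have hK1 : (0 : ℝ) < ((K + 1 : ℕ) : ℝ) := by positivity
  refine quantitativeBGN_of_surfaceVolumeTail
    ⟨(1 - b) / ((K + 1 : ℕ) : ℝ), (C₁ / c) ^ (1 / ((K + 1 : ℕ) : ℝ)), div_pos (by linarith) hK1, fun n hn => ?_⟩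
  -- `w(n) = P(volDn n)` (STUB 1) and the power bound
  rw [← (stub_mirrorSymm (criticalProbI 3) n).2]
  have hpow : c * (n : ℝ) ^ (-b) *
      (bondPercolation (zdGraph 3) (criticalProbI 3)).real
        {ω | (n : ℕ∞) ≤ (openClusterIn (withinGraph (zdGraph 3) {x : Site 3 | x 0 ≤ 0}) ω 0).encard} ^ (K + 1) ≤
      C₁ * (n : ℝ) ^ (-(1 : ℝ)) := by
    refine (h n hn).trans ?_
    have e : C₁ * (n : ℝ) ^ (-(1 : ℝ)) = C₁ / n := by
      rw [Real.rpow_neg_one, div_eq_mul_inv]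
    rw [e]
    exact thinFoot_packing_criticalProb n k hn
  exact tail_bound_of_pow_bound hn (by omega) measureReal_nonneg hc hC₁0 hpow

end Summit.CriticalPhenomena.PercolationContinuityZ3.Theorems

end
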